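import Summits.BirchSwinnertonDyer.BirchSwinnertonDyer.Theorems.EisensteinPrimesMazurMCOnCellBCongruenceRoadIsogeny
import Summits.BirchSwinnertonDyer.BirchSwinnertonDyer.Theorems.EisensteinPrimesMazurMCOnX1RankZeroLocate
import Summits.BirchSwinnertonDyer.BirchSwinnertonDyer.Theorems.Rank1ResidualX1Isogeny
import Summits.BirchSwinnertonDyer.Rank1Residual.X1.MuPart
import Literature.NumberTheory.EllipticCurves.SupersingularIrreducibleProofs
import Literature.NumberTheory.EllipticCurves.AnalyticRankModularityProofs
import HarnessLib

/-!
# Crux `MazurMCOnX1RankZero` (stmt-BirchSwinnertonDyer-19035), line `mudescent`, stub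
# `stub_analyticMuZero_offLocus`: the CONGRUENCE ROAD at a GOOD anomalous Eisenstein prime —
# obstruction, typed reduction and negative lemma (cell `bsd-eis`, seat `bsd-eis-mu-c`; the
# crux-5 twin of `EisensteinPrimesMazurMCOnCellBCongruenceRoad(Negative).lean`; closes NO stub)

Crux 5's open stub reads `ClassX1 W₀ p → W₀.analyticRank = 0 → ¬ HasRamifiedOddLineAt W₀ p →
X1.MuPart.AnalyticMuLE W₀ p 0` (ky g7 skeleton `d113fc0a…`): analytic `μ = 0` for the Mazur–
Swinnerton-Dyer `p`-adic `L`-function at the étale end of a rank-`0` type-A class at a GOOD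
anomalous Eisenstein `p` (row A3; `X₁(11)` at `5`). The congruence road — transport `μ_an = 0` from a
congruent curve `W′`, `W₀[p] ≅ W′[p]` (`TorsionIso`), by a Greenberg–Vatsal-type `μ`-invariance — meets
the same three walls as at `p ‖ N` (companion files `…CongruenceRoad.lean`, `…CongruenceRoadIsogeny.lean`): GV Thm. (1.4)/(3.10) and EPW Thm. 1 are printed
for IRREDUCIBLE `E[p]` only; GV Thm. (1.3) needs `GVPar`; the reducible analytic machinery (GV (3.12),
canonical period for the admissible sign `−ψ(−1)`) reads the odd branch on type A (GV p. 5: «if E is a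
quadratic twist of J by an even character, we can prove very little»).

WHAT THIS FILE PROVES (theorems only; no `def`, no named fact):
* §1 OBSTRUCTION at good `p`: a congruent partner `W′` of a rank-`0` X1 étale end is reducible,
  type A, off the locus (`partner_red_notGVPar_offLocus`); a GOOD partner is again ANOMALOUS
  (`anom_of_torsionIso_of_anom`: `a_p ≡ 1 (mod p)` is a property of the `Γ_ℚ`-module `E[p]` at a good
  `p > 2`, by x1a's decomposition dictionary transported along the isomorphism), hence in `ClassX1`
  with `¬ GVPar` — the same open cell (`partner_classX1`); a MULTIPLICATIVE partner is SPLIT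
  (`partner_split_of_mult`, contrapositive of the tree's non-split ⇒ non-anomalous) and, in rank `0`,
  an X2b pair (`partner_cellB_of_mult`) — row A10, open. No printed `μ_an = 0` anywhere on the road.
* §2 TYPED REDUCTION: the registered stub follows from (T₁) a `TorsionIso`-transfer of
  `X1.MuPart.AnalyticMuLE · p 0` among good-ordinary reducible pairs (UNPRINTED; hypothesis) and (S₁)
  a congruent good-ordinary `μ_an = 0` partner per étale end (`stub_analyticMuZero_offLocus_of_congruenceRoad`).
* §3 NEGATIVE LEMMA: an ISOGENY-invariant transfer (any notion reading only `E[p]^{ss}` / `a_ℓ mod p`)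
  makes the stub's conclusion FALSE at every rank-`0` X1 étale end, relative to Greenberg Prop. 5.7,
  Wuthrich 2014 Thm. 16 (good ordinary reducible form `charIdeal_dvd_padicLFunction`) and modularity
  (`not_analyticMuLE_zero_of_isogenyTransfer`); with the stub and the LANDED `stub_locate` (p443510)
  it would empty the rank-`0` part of `ClassX1` (`analyticRank_ne_zero_of_isogenyTransfer_of_stub`).

PRINTED CONTEXT at good `p` (bsd-eis LIT-DOSSIER §10/§10b/§10d). The ALGEBRAIC twin of the stub is
Trifković's Conj. 2 (CJM 57 (2005) p. 815): «If `E[p]` lives in a non-split sequence of `G_ℚ`-modules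
`0 → ℤ/pℤ → E[p] → μ_p → 0`, then `μ(E)_p = 0`» — the étale end of the companion's §2 (unique rational
line, unramified-even ⇒ non-split); his Cor. 1 puts the `μ`-minimal member at `E/M` (`M` = maximal
cyclic rational ramified-odd subgroup) and his Lemma 1 is Schneider's table (`μ(E/C) = μ(E) + n` for `C`
cyclic of order `pⁿ` EVEN and UNRAMIFIED — the jump the negative lemma below detects); his Thms. 3–4
are per-curve flat-cohomology CRITERIA for `μ_alg = 0` at `p = 3, 5` («no two of our examples having
isomorphic p-torsion»), nothing class-wide and nothing analytic. The printed prototype of a reducible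
`μ`-theory under congruences is Bellaïche–Pollack 2019 (tame level 1: Thm. 1.8 `μ ≤ ord_p(a_p(f) − 1)`,
Cor. 1.11 a main conjecture WITH `μ > 0`), not available for `E/ℚ` of type A; Ray's type-3 results are
conditional. HONEST FRAMING: a PROBE; nothing here proves or refutes the stub. References:
[GreenbergVatsal2000] Thms. (1.3), (1.4), (3.10), (3.12), pp. 5, 32–33; [SerreInventiones1972] §1.11
Prop. 11–12; [GreenbergLNM1716] Prop. 5.7, Conj. 1.11, §5; [Wuthrich2014] Thm. 16;
[EmertonPollackWeston2006] Thm. 1; [Trifkovic2005] Lemma 1, Cor. 1, Conj. 2, Thms. 3–4;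
[BellaichePollack2019] Thms. 1.7, 1.8, Cor. 1.11; [Schneider1987MuIsogenies]; [PerrinRiou1989Isogenie];
HOME `run/shared/lean/pub/bsd-eis/mu-c-MEMO-1.md`.
-/

set_option autoImplicit false

-- `Summit.BirchSwinnertonDyer.BirchSwinnertonDyer.…`: the summit and its single sub-problem share a name (D-0017 layout).
set_option linter.dupNamespace false

noncomputable section

open scoped Classical

open WeierstrassCurve NumberField IsDedekindDomain Field
  Literature.NumberTheory.EllipticCurves
  Literature.NumberTheory.EllipticCurves.Rank1Residual
  Literature.NumberTheory.GaloisRepresentations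
  Literature.Barriers.BirchSwinnertonDyer
  Summit.BirchSwinnertonDyer.Rank1Residual
  Summit.BirchSwinnertonDyer.Rank1Residual.X1.CongruenceTransfer
  Summit.BirchSwinnertonDyer.BirchSwinnertonDyer.Theorems.EisensteinPrimesMazurMCOnCellBCongruenceRoad
  Summit.BirchSwinnertonDyer.BirchSwinnertonDyer.Theorems.EisensteinPrimesMazurMCOnCellBCongruenceRoadIsogeny

namespace Summit.BirchSwinnertonDyer.BirchSwinnertonDyer.Theorems.EisensteinPrimesMazurMCOnX1RankZeroCongruenceRoad

variable {W W' : WeierstrassCurve ℚ} {p : ℕ} [hp : Fact p.Prime]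

/-! ## §1 The obstruction at a good anomalous Eisenstein prime -/

/-- **Every congruent partner of a rank-`0` X1 étale end is a reducible, type-A, off-locus Eisenstein
curve** (`ClassX1 ∧ r_an = 0` gives `¬ GVPar`; then `X2.gvPar_iff_of_torsionIso`,
`hasRamifiedOddLineAt_iff_of_torsionIso`, `red_iff_of_torsionIso`): outside GV Thm. (1.3) (`GVPar`)
and GV Thm. (1.4)/(3.10), EPW Thm. 1 (irreducible).
[cite: GreenbergVatsal2000, Thm. (1.3) and Thm. (1.4) («these are irreducible»)] -/
theorem partner_red_notGVPar_offLocus [W.IsGloballyMinimal]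
    (hX1 : ClassX1 W p) (hr0 : W.analyticRank = 0) (hoff : ¬ HasRamifiedOddLineAt W p)
    (hiso : TorsionIso W W' p) :
    ¬ W'.HasIrreducibleModPGaloisRep p ∧ ¬ GVPar W' p ∧ ¬ HasRamifiedOddLineAt W' p :=
  ⟨(red_iff_of_torsionIso hiso).mp hX1.2.1,
    X2.not_gvPar_of_torsionIso_of_not_gvPar hiso (fun h ↦ hX1.2.2.2.2 ⟨hr0, h⟩),
    fun h ↦ hoff ((hasRamifiedOddLineAt_iff_of_torsionIso hiso).mpr h)⟩

/-- **Anomaly is a property of the `Γ_ℚ`-module `E[p]` (good `p > 2`, reducible).** If `W` is good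
and anomalous at `p` (`a_p ≡ 1`), `W[p]` reducible, `W′` good at `p` and `W[p] ≅ W′[p]`, then `W′` is
anomalous: x1a's dictionary (Serre §1.11: `a_p ≡ 1` iff the decomposition group at a prime above `p`
fixes the rational line pointwise or acts trivially on the quotient) on both sides, transported by the
tree's `forall_fix_map_iff` / `forall_quot_map_iff`. [cite: SerreInventiones1972, §1.11 (1), Prop. 11–12] -/
theorem anom_of_torsionIso_of_anom [W.IsElliptic] [W.IsGloballyMinimal] [W'.IsElliptic]
    [W'.IsGloballyMinimal] (hp2 : 2 < p) (hanom : Anom W p)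
    (hgood' : W'.HasGoodReductionAtPrime p) (hiso : TorsionIso W W' p) : Anom W' p := by
  have hpp := hp.out
  obtain ⟨e, he⟩ := hiso
  have hred : ¬ W.HasIrreducibleModPGaloisRep p := hanom.1
  have hgood : W.HasGoodReductionAtPrime p := hanom.2.1
  set v : HeightOneSpectrum (𝓞 ℚ) := (Rat.HeightOneSpectrum.primesEquiv).symm ⟨p, hpp⟩ with hvdef
  have hv : (Rat.HeightOneSpectrum.primesEquiv v : ℕ) = p := by
    rw [hvdef, Equiv.apply_symm_apply]
  obtain ⟨Φ, hΦ⟩ := exists_isRationalLine_of_not_irr W p hred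
  have hΦ' : IsRationalLine W' p (Φ.map e.toAddMonoidHom) :=
    X2.CongruentPartnerAnomalous.isRationalLine_map_equiv e he hΦ
  have h𝔓 := adicCompletionPrime_mem_primesAbove ℚ v
  have hE := (anom_iff_decomposition_of_mem_primesAbove hp2 hgood hv h𝔓 hΦ).mp hanom
  refine (anom_iff_decomposition_of_mem_primesAbove hp2 hgood' hv h𝔓 hΦ').mpr ?_
  rcases hE with hfix | hquot
  · exact Or.inl ((X2.CongruentPartnerAnomalous.forall_fix_map_iff e he _ Φ).mpr hfix)
  · exact Or.inr ((X2.CongruentPartnerAnomalous.forall_quot_map_iff e he _ Φ).mpr hquot)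

/-- **A GOOD congruent partner of a rank-`0` X1 étale end is again an anomalous type-A pair of the
open cell `ClassX1`** (any rank; with `¬ GVPar` the rank clause of `ClassX1` is automatic) — rows
A1/A3 again: the good side of the congruence road never leaves the crux's own open cell; no printed
theorem gives `μ_an(W′) = 0` there (Keller–Yin is a preprint and asserts a main conjecture, not `μ`).
[cite: GreenbergVatsal2000, p. 5 («we can prove very little») and Thm. (1.3)] -/
theorem partner_classX1 [W.IsElliptic] [W.IsGloballyMinimal] [W'.IsElliptic] [W'.IsGloballyMinimal]
    (hX1 : ClassX1 W p) (hr0 : W.analyticRank = 0) (hoff : ¬ HasRamifiedOddLineAt W p)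
    (hiso : TorsionIso W W' p) (hgood' : W'.HasGoodReductionAtPrime p) :
    ClassX1 W' p ∧ ¬ GVPar W' p ∧ ¬ HasRamifiedOddLineAt W' p := by
  obtain ⟨hred', hA', hoff'⟩ := partner_red_notGVPar_offLocus hX1 hr0 hoff hiso
  have hanom' : Anom W' p := anom_of_torsionIso_of_anom hX1.1 hX1.2.2.2.1 hgood' hiso
  exact ⟨⟨hX1.1, hred', hgood', hanom', fun h ↦ hA' h.2⟩, hA', hoff'⟩

/-- **A MULTIPLICATIVE congruent partner of a (good, anomalous) X1 étale end is SPLIT multiplicative**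
— contrapositive of the tree's «non-split X2 pair ⇒ every good relative is NON-anomalous»
(`X2.CongruentPartnerAnomalous.not_dvd_frobeniusTrace_sub_one_of_torsionIso_of_not_split`, A41
discharged) read backwards along `TorsionIso.symm`. [cite: SerreInventiones1972, §1.11 Prop. 11–12]
[cite: GreenbergVatsal2000, §2 pp. 14–15] -/
theorem partner_split_of_mult [W.IsElliptic] [W.IsGloballyMinimal] [W'.IsElliptic]
    [W'.IsGloballyMinimal] (hX1 : ClassX1 W p) (hiso : TorsionIso W W' p)
    (hmult' : W'.HasMultiplicativeReductionAtPrime p) :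
    W'.HasSplitMultiplicativeReductionAtPrime p := by
  by_contra hns
  have hp2 : p ≠ 2 := by have := hX1.1; omega
  have hred' : ¬ W'.HasIrreducibleModPGaloisRep p := (red_iff_of_torsionIso hiso).mp hX1.2.1
  exact X2.CongruentPartnerAnomalous.not_dvd_frobeniusTrace_sub_one_of_torsionIso_of_not_split
    TateCurve.Silverman1994_thmV53_corV54_tateUniformisation_holds hp2 hmult' hns hred' hX1.2.2.1
    hiso.symm hX1.2.2.2.1.2.2

/-- **In rank `0`, a MULTIPLICATIVE congruent partner of an X1 étale end is an (off-locus, SPLIT) X2b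
pair** — row A10, the other open Eisenstein cell of the route. [cite: GreenbergVatsal2000, §2 pp. 14–15] -/
theorem partner_cellB_of_mult [W.IsElliptic] [W.IsGloballyMinimal] [W'.IsElliptic]
    [W'.IsGloballyMinimal] (hX1 : ClassX1 W p) (hr0 : W.analyticRank = 0)
    (hoff : ¬ HasRamifiedOddLineAt W p) (hiso : TorsionIso W W' p)
    (hmult' : W'.HasMultiplicativeReductionAtPrime p) (hr0' : W'.analyticRank = 0) :
    X2.CellB W' p ∧ W'.HasSplitMultiplicativeReductionAtPrime p ∧ ¬ HasRamifiedOddLineAt W' p := by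
  obtain ⟨hred', hA', hoff'⟩ := partner_red_notGVPar_offLocus hX1 hr0 hoff hiso
  have hp2 : p ≠ 2 := by have := hX1.1; omega
  exact ⟨⟨hr0', ⟨hp2, hred', hmult'⟩, hA'⟩, partner_split_of_mult hX1 hiso hmult', hoff'⟩

/-! ## §2 The typed reduction at good `p` -/

/-- **The congruence road at a good anomalous prime, typed: EXACTLY the registered crux-5 stub as
conclusion.** From (T₁) a `TorsionIso`-transfer of `X1.MuPart.AnalyticMuLE · p 0` among good-ordinary
reducible pairs — UNPRINTED (GV Thm. (3.10) is its irreducible case), a HYPOTHESIS, not a fact — and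
(S₁) for every rank-`0` X1 étale end a congruent good-ordinary partner with `μ_an = 0` (by §1 again an
anomalous type-A étale end: no printed supply). Closes nothing.
[cite: GreenbergVatsal2000, Thm. (1.4), Thm. (3.10)] -/
theorem stub_analyticMuZero_offLocus_of_congruenceRoad
    (hT : ∀ (p : ℕ) [Fact p.Prime] (V V' : WeierstrassCurve ℚ) [V.IsElliptic] [V.IsGloballyMinimal]
        [V'.IsElliptic] [V'.IsGloballyMinimal], V.HasGoodReductionAtPrime p →
        ¬ (p : ℤ) ∣ V.frobeniusTrace p → ¬ V.HasIrreducibleModPGaloisRep p → TorsionIso V V' p →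
        V'.HasGoodReductionAtPrime p → ¬ (p : ℤ) ∣ V'.frobeniusTrace p →
        X1.MuPart.AnalyticMuLE V' p 0 → X1.MuPart.AnalyticMuLE V p 0)
    (hS : ∀ (W₀ : WeierstrassCurve ℚ) [W₀.IsElliptic] [W₀.IsGloballyMinimal] (p : ℕ) [Fact p.Prime],
        ClassX1 W₀ p → W₀.analyticRank = 0 → ¬ HasRamifiedOddLineAt W₀ p →
        ∃ (W' : WeierstrassCurve ℚ) (_ : W'.IsElliptic) (_ : W'.IsGloballyMinimal),
          TorsionIso W₀ W' p ∧ W'.HasGoodReductionAtPrime p ∧ ¬ (p : ℤ) ∣ W'.frobeniusTrace p ∧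
            X1.MuPart.AnalyticMuLE W' p 0) :
    ∀ (W₀ : WeierstrassCurve ℚ) [W₀.IsElliptic] [W₀.IsGloballyMinimal] (p : ℕ) [Fact p.Prime],
      ClassX1 W₀ p → W₀.analyticRank = 0 → ¬ HasRamifiedOddLineAt W₀ p →
        X1.MuPart.AnalyticMuLE W₀ p 0 := by
  intro W₀ _ _ p _ hX1 hr0 hoff
  obtain ⟨W', _, _, hiso, hgood', hord', hμ'⟩ := hS W₀ p hX1 hr0 hoff
  obtain ⟨hgood, hord⟩ := goodOrd_of_red_of_good W₀ p hX1.1 hX1.2.2.1 hX1.2.1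
  exact hT p W₀ W' hgood hord hX1.2.1 hiso hgood' hord' hμ'

/-! ## §3 The negative lemma at good `p` (X1 currency) -/

/-- **NEGATIVE LEMMA at a good anomalous prime — an ISOGENY-invariant transfer of analytic `μ = 0`
contradicts the stub at every rank-`0` X1 étale end.** Relative to Greenberg's Prop. 5.7 (`h57`),
Wuthrich 2014 Thm. 16 at a good ordinary reducible prime (`hW16`) and modularity (`hmod`): IF
`X1.MuPart.AnalyticMuLE · p 0` passed from a good-ordinary reducible pair to every `ℚ`-isogenous
curve, THEN it FAILS at every good-ordinary reducible type-A off-locus `W₀`: at the neighbour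
`W₁ = W₀/Φ` on the locus (companion `exists_isIsogenous_hasRamifiedOddLineAt_of_offLocus`) Kato's
direction (`X1.MuPart.mu_eq_zero_of_analyticMuLE_zero`) gives `μ(X(W₁/ℚ_∞)) = 0` against `μ ≥ 1`
(`EisensteinMuBarrier`; `X₁(11) → X₀(11)` at `5`: `μ = 0 → 1`; Schneider's table as printed by
Trifković, Lemma 1: `μ(E/C)_p = μ(E)_p + n` for `C` cyclic of order `pⁿ`, even and unramified).
[cite: GreenbergLNM1716, Prop. 5.7 (p. 113) and §5] [cite: Wuthrich2014, Thm. 16 (p. 397)]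
[cite: Trifkovic2005, Lemma 1 (p. 814) and Conj. 2 (p. 815)] -/
theorem not_analyticMuLE_zero_of_isogenyTransfer [W.IsElliptic] [W.IsGloballyMinimal]
    (h57 : Greenberg1999.prop57_one_le_mu_of_ramified_odd_line)
    (hW16 : Wuthrich2014.charIdeal_dvd_padicLFunction)
    (hmod : ModularForms.nonempty_modularParametrizationData)
    (hTiso : ∀ (V V' : WeierstrassCurve ℚ) [V.IsElliptic] [V.IsGloballyMinimal] [V'.IsElliptic]
        [V'.IsGloballyMinimal], V.HasGoodReductionAtPrime p → ¬ (p : ℤ) ∣ V.frobeniusTrace p →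
        ¬ V.HasIrreducibleModPGaloisRep p → IsIsogenous V V' →
        X1.MuPart.AnalyticMuLE V p 0 → X1.MuPart.AnalyticMuLE V' p 0)
    (hp2 : p ≠ 2) (hgood : W.HasGoodReductionAtPrime p) (hord : ¬ (p : ℤ) ∣ W.frobeniusTrace p)
    (hred : ¬ W.HasIrreducibleModPGaloisRep p) (hA : ¬ GVPar W p)
    (hoff : ¬ HasRamifiedOddLineAt W p) : ¬ X1.MuPart.AnalyticMuLE W p 0 := by
  intro hμ
  obtain ⟨W₁, _, _, hiso, hloc, hred₁'⟩ :=
    exists_isIsogenous_hasRamifiedOddLineAt_of_offLocus hp2 (Or.inl ⟨hgood, hord⟩) hred hA hoff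
  have hgood₁ : W₁.HasGoodReductionAtPrime p :=
    X2.IsogenyLineTypeGoodOrdinary.hasGoodReductionAtPrime_of_isIsogenous hiso hgood
  have hord₁ : ¬ (p : ℤ) ∣ W₁.frobeniusTrace p :=
    X2.IsogenyLineTypeGoodOrdinary.not_dvd_frobeniusTrace_of_isIsogenous hiso hgood hord
  obtain ⟨Ψ, hΨ⟩ := hloc.exists_isRationalLine
  have hred₁ : ¬ W₁.HasIrreducibleModPGaloisRep p := not_hasIrreducibleModPGaloisRep_of_isRationalLine hΨ
  have hμ₁ : X1.MuPart.AnalyticMuLE W₁ p 0 := hTiso W W₁ hgood hord hred hiso hμ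
  obtain ⟨κ, hκ, γ, hγ, hγ'⟩ := exists_isCyclotomic_isTopGenerator_isCyclotomicVariable_holds p
  obtain ⟨D⟩ := W₁.nonempty_selmerDualData_holds κ γ hγ
  haveI : Module.Finite (IwasawaAlgebra p) D.X := D.module_finite_holds hγ
  haveI : NeZero (W₁.conductorNorm ℤ) := ⟨(W₁.conductorNorm_pos_holds).ne'⟩
  have hD : D.IsTorsion :=
    (X1.MuPart.isTorsion_and_exists_factorisation hW16 hmod hp2 hgood₁ hord₁ hred₁ hκ hγ hγ' D).1
  have hmu : D.mu = 0 :=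
    X1.MuPart.mu_eq_zero_of_analyticMuLE_zero hW16 hmod hp2 hgood₁ hord₁ hred₁ hμ₁ hκ hγ hγ' D
  exact EisensteinMuBarrier.mu_ne_zero h57 hp2 (Or.inl ⟨hgood₁, hord₁⟩) hloc hκ hγ D hD hmu

/-- **The negative lemma on the cell: an isogeny-invariant transfer makes the crux-5 stub's conclusion
FALSE at every rank-`0` X1 étale end** (relative to Prop. 5.7, Wuthrich Thm. 16, modularity).
[cite: GreenbergLNM1716, Prop. 5.7 (p. 113)] [cite: Wuthrich2014, Thm. 16 (p. 397)] -/
theorem not_analyticMuLE_zero_of_isogenyTransfer_of_classX1 [W.IsElliptic] [W.IsGloballyMinimal]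
    (h57 : Greenberg1999.prop57_one_le_mu_of_ramified_odd_line)
    (hW16 : Wuthrich2014.charIdeal_dvd_padicLFunction)
    (hmod : ModularForms.nonempty_modularParametrizationData)
    (hTiso : ∀ (V V' : WeierstrassCurve ℚ) [V.IsElliptic] [V.IsGloballyMinimal] [V'.IsElliptic]
        [V'.IsGloballyMinimal], V.HasGoodReductionAtPrime p → ¬ (p : ℤ) ∣ V.frobeniusTrace p →
        ¬ V.HasIrreducibleModPGaloisRep p → IsIsogenous V V' →
        X1.MuPart.AnalyticMuLE V p 0 → X1.MuPart.AnalyticMuLE V' p 0)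
    (hX1 : ClassX1 W p) (hr0 : W.analyticRank = 0) (hoff : ¬ HasRamifiedOddLineAt W p) :
    ¬ X1.MuPart.AnalyticMuLE W p 0 := by
  have hp2 : p ≠ 2 := by have := hX1.1; omega
  obtain ⟨hgood, hord⟩ := goodOrd_of_red_of_good W p hX1.1 hX1.2.2.1 hX1.2.1
  exact not_analyticMuLE_zero_of_isogenyTransfer h57 hW16 hmod hTiso hp2 hgood hord hX1.2.1
    (fun h ↦ hX1.2.2.2.2 ⟨hr0, h⟩) hoff

/-- **COROLLARY — an isogeny-invariant transfer principle AND the crux-5 stub leave NO rank-`0` X1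
pair**: every such pair descends (LANDED `stub_locate`, p443510) to an off-locus isogenous `W₀`, again
`ClassX1` of analytic rank `0` (`ClassX1.of_isIsogenous`, `analyticRank_eq_of_isIsogenous'`), where §3
and the stub collide. Row A3 has 149 census classes, so: the road with a semisimple / `a_ℓ`-congruence
notion is DEAD at good `p` too. [cite: GreenbergLNM1716, Prop. 5.7 (p. 113) and Conj. 1.11 (p. 58)]
[cite: Wuthrich2014, Thm. 16 (p. 397)] -/
theorem analyticRank_ne_zero_of_isogenyTransfer_of_stub
    (h57 : Greenberg1999.prop57_one_le_mu_of_ramified_odd_line)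
    (hW16 : Wuthrich2014.charIdeal_dvd_padicLFunction)
    (hmod : ModularForms.nonempty_modularParametrizationData)
    (hTiso : ∀ (V V' : WeierstrassCurve ℚ) [V.IsElliptic] [V.IsGloballyMinimal] [V'.IsElliptic]
        [V'.IsGloballyMinimal], V.HasGoodReductionAtPrime p → ¬ (p : ℤ) ∣ V.frobeniusTrace p →
        ¬ V.HasIrreducibleModPGaloisRep p → IsIsogenous V V' →
        X1.MuPart.AnalyticMuLE V p 0 → X1.MuPart.AnalyticMuLE V' p 0)
    (hstub : ∀ (W₀ : WeierstrassCurve ℚ) [W₀.IsElliptic] [W₀.IsGloballyMinimal],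
        ClassX1 W₀ p → W₀.analyticRank = 0 → ¬ HasRamifiedOddLineAt W₀ p →
          X1.MuPart.AnalyticMuLE W₀ p 0)
    (W : WeierstrassCurve ℚ) [W.IsElliptic] [W.IsGloballyMinimal] (hX1 : ClassX1 W p) :
    W.analyticRank ≠ 0 := by
  intro hr0
  obtain ⟨W₀, _, _, hiso, hoff⟩ := EisensteinPrimesMazurMCOnX1RankZeroLocate.stub_locate W p hX1 hr0
  have hX1₀ : ClassX1 W₀ p := ClassX1.of_isIsogenous hiso hX1
  have hr0₀ : W₀.analyticRank = 0 := by rw [← analyticRank_eq_of_isIsogenous' hiso]; exact hr0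
  exact not_analyticMuLE_zero_of_isogenyTransfer_of_classX1 h57 hW16 hmod hTiso hX1₀ hr0₀ hoff
    (hstub W₀ hX1₀ hr0₀ hoff)

end Summit.BirchSwinnertonDyer.BirchSwinnertonDyer.Theorems.EisensteinPrimesMazurMCOnX1RankZeroCongruenceRoad

end
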